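import Summits.BirchSwinnertonDyer.Rank1Residual.O5.FlexCubeResidueClassesThree
import Summits.BirchSwinnertonDyer.Rank1Residual.O5.ThreeTorsionNormalFormFormalCube
import Summits.BirchSwinnertonDyer.Rank1Residual.O5.ThreeTorsionNormalFormValuation
import HarnessLib

/-!
# The `3`-adic flex form `y² + a·xy + d·y = x³` with `v₃(c₄) = 2`, `v₃(Δ) ≥ 6`: EVERY `y` is a cube
# (cell `b2b-bsdres`, team n1011, ROW T-FLEX-PTW FILE P1b — class-free TOOL; seat `b2b-bsdres-n1011-p18`
#  GEN 16 under the idle rule; END file = `O5/TrivialKummerImagePotTwistThreeProofs.lean`, T29.4 (b2)/(b3))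

HONEST FRAMING (cell `b2b-bsdres`, run/shared/lean/b2b/bsd-rank1-residual/, verbatim in every file): the
goal of the cell is to DELETE the COMBINATION-SHAPED residual classes of the Birch–Swinnerton-Dyer formula
for ALL analytic-rank `≤ 1` elliptic curves over `ℚ` — "full BSD formula for every rank `≤ 1` curve in
class `C`" assembled STRICTLY from published theorems — so that the rank-`≤ 1` remainder becomes exactly
the CONSTRUCTION-SHAPED classes, which are TYPED (missing-input `Prop`s), NOT attempted. This is not
"finishing BSD". Lane CLASS-CLOSURE / O5 (O5 OPEN): research route; census output (P-K18 / P-K19) is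
EVIDENCE, never a Literature fact; nothing is booked; no mark of `RESIDUAL-MAP.md` moves. This file:
THEOREMS ONLY (no definition, no named fact, no `@[conjecture]` node, no `sorry`; net named-fact debt `0`).
It proves NOTHING about any elliptic curve, Kodaira symbol, conductor or Selmer group: pure `3`-adic
algebra about the one cubic equation `y² + a·xy + d·y = x³` over `ℚ₃`.

## What is proved

* `norm_eq_of_valuation_c₄_Δ` (the SHAPE): for `a, d ∈ ℚ₃` with `v₃(a(a³ − 24d)) = 2` (`v₃ c₄ = 2`) and
  `v₃(d³(a³ − 27d)) ≥ 6` (`v₃ Δ ≥ 6`): `‖d‖ = 1`, `‖a‖ = 3⁻¹` and `‖(a/3)³ − d‖ ≤ 3⁻³` — the flex form is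
  `y² + 3b·xy + d·y = x³` with units `b, d` and `b³ ≡ d (mod 27)`.  (Three-case valuation analysis on
  `v₃ a`: `v₃ a ≤ 0` forces `v₃ Δ = 12 v₃ a − 3 < 0`, `v₃ a ≥ 2` forces `v₃ Δ = 7 − 4 v₃ a < 0`.)  In the
  O5 lane's dictionary (o5-r1 GEN 13, T30 §1, Case N) these are exactly the cells `(b̄, ā₉) = (1, 1)`,
  `w = v₃(b³ − A₃) ≥ 3`: Kodaira `I₀*` potentially ORDINARY (`w = 3`) and `Iₙ*` (`w = n + 3`).
* `exists_pow_three_eq_of_valuation_c₄_Δ` (T29.4 (b2)/(b3) in coordinates): under the same two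
  hypotheses EVERY affine solution `(x, y)` over `ℚ₃` has `y ∈ ℚ₃³` (a cube; `x ≠ 0` is not needed).
  Non-integral points: x11b3-p7's `ThreeTorsionNormalForm.exists_pow_three_eq_of_one_lt_norm` (p309913);
  integral points: FILE P1a's `exists_pow_three_eq_of_integral` (`O5/FlexCubeResidueClassesThree.lean`:
  residue classes `(0,0)`, `(0,−d̄)`, cusp `(−1, d̄)` of `ȳ² + d̄ȳ = x̄³`).  NO group law, NO Néron model,
  NO Tate run, NO isogeny invariant `a(φ)`.

References: T. and V. Dokchitser, *Local invariants of isogenous elliptic curves*, Trans. AMS 367 (2015),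
Prop. 16–18 (arXiv:1208.5519 p. 8) — the statement behind T29.4; E. F. Schaefer, J. Number Theory 56
(1996), Lemma 3.8; folklore `ℤ₃³ ∩ ℤ₃ˣ = ±1 + 9ℤ₃`; o5-r1 GEN 12 `T29-RATIONAL-TORSION-COST-LAW.md`
(law T29.4 (b2)/(b3), census P-K18 kit j141165: 2 574/2 574 `Iₙ*` + 2 125/2 125 `I₀*` class-01 curves
have `k = 0`) and GEN 13 `T30-FLAT-KUMMER-NORMAL-FORM.md` §1 (Case N cells `(1,1)`, `w ≥ 3`).
-/

noncomputable section

open Padic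
open Literature.NumberTheory.EllipticCurves.TwoDescentLocal (valuation_neg' valuation_add_eq_left_of_lt)

namespace Summit.BirchSwinnertonDyer.Rank1Residual.O5.FlexTangent

/-! ## §3 The shape: `v₃ c₄ = 2`, `v₃ Δ ≥ 6` forces `d ∈ ℤ₃ˣ`, `a = 3b`, `b³ ≡ d (mod 27)` -/

section Shape

/-- **The shape of the flex form from `c₄` and `Δ`.** For `a, d ∈ ℚ₃` with
`v₃(a·(a³ − 24d)) = 2` and `v₃(d³(a³ − 27d)) ≥ 6` (the `c₄` and `Δ` of `y² + a·xy + d·y = x³`):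
`‖d‖ = 1`, `‖a‖ = 3⁻¹` and `‖(a/3)³ − d‖ ≤ 3⁻³`.  Cases on `v₃ a`: if `v₃ a ≤ 0` then
`v₃(a³ − 24d) = 2 − v₃ a > 3 v₃ a` forces `v₃ d = 3v₃ a − 1` and `v₃ Δ = 12 v₃ a − 3 < 6`; if `v₃ a ≥ 2`
then `v₃ d = 1 − v₃ a` and `v₃ Δ = 7 − 4 v₃ a < 6`; so `v₃ a = 1`, `v₃ d = 0`, and then
`27((a/3)³ − d) = a³ − 27d` has valuation `v₃ Δ ≥ 6`. [folklore] -/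
theorem norm_eq_of_valuation_c₄_Δ {a d : ℚ_[3]} (hc₄0 : a * (a ^ 3 - 24 * d) ≠ 0)
    (hc₄ : (a * (a ^ 3 - 24 * d)).valuation = 2) (hΔ0 : d ^ 3 * (a ^ 3 - 27 * d) ≠ 0)
    (hΔ : 6 ≤ (d ^ 3 * (a ^ 3 - 27 * d)).valuation) :
    ‖d‖ = 1 ∧ ‖a‖ = (3 : ℝ)⁻¹ ∧ ‖(a / 3) ^ 3 - d‖ ≤ (3 : ℝ)⁻¹ ^ 3 := by
  have hv3 : (3 : ℚ_[3]).valuation = 1 := by exact_mod_cast Padic.valuation_p (p := 3)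
  have hv27 : (27 : ℚ_[3]).valuation = 3 := by
    rw [show (27 : ℚ_[3]) = (3 : ℚ_[3]) ^ 3 by norm_num, Padic.valuation_pow, hv3]; norm_num
  have hv8 : (8 : ℚ_[3]).valuation = 0 := by
    have h : ‖((8 : ℤ) : ℚ_[3])‖ = 1 := by
      refine le_antisymm (Padic.norm_int_le_one _) (not_lt.1 fun hlt => ?_)
      rw [Padic.norm_intCast_lt_one_iff] at hlt; norm_num at hlt
    have h' : ‖(8 : ℚ_[3])‖ = 1 := by simpa using h
    exact (ThreeTorsionNormalForm.norm_eq_one_iff.mp h').2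
  have hv24 : (24 : ℚ_[3]).valuation = 1 := by
    rw [show (24 : ℚ_[3]) = 3 * 8 by norm_num, Padic.valuation_mul (by norm_num) (by norm_num), hv3, hv8]
    norm_num
  have ha0 : a ≠ 0 := fun h => hc₄0 (by rw [h, zero_mul])
  have hd0 : d ≠ 0 := fun h => hΔ0 (by rw [h]; ring)
  have he0 : a ^ 3 - 24 * d ≠ 0 := fun h => hc₄0 (by rw [h, mul_zero])
  have hD0 : a ^ 3 - 27 * d ≠ 0 := fun h => hΔ0 (by rw [h, mul_zero])
  have ha3 : a ^ 3 ≠ 0 := pow_ne_zero _ ha0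
  have hva3 : (a ^ 3).valuation = 3 * a.valuation := by rw [Padic.valuation_pow]; push_cast; ring
  have h24d : (-(24 * d)).valuation = 1 + d.valuation := by
    rw [valuation_neg', Padic.valuation_mul (by norm_num) hd0, hv24]
  have h24dne : -(24 * d) ≠ 0 := neg_ne_zero.mpr (mul_ne_zero (by norm_num) hd0)
  have h27d : (-(27 * d)).valuation = 3 + d.valuation := by
    rw [valuation_neg', Padic.valuation_mul (by norm_num) hd0, hv27]
  have h27dne : -(27 * d) ≠ 0 := neg_ne_zero.mpr (mul_ne_zero (by norm_num) hd0)
  -- valuations of `c₄` and `Δ` in additive form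
  have hc₄' : a.valuation + (a ^ 3 - 24 * d).valuation = 2 := by
    rw [Padic.valuation_mul ha0 he0] at hc₄; exact hc₄
  have hΔ' : 6 ≤ 3 * d.valuation + (a ^ 3 - 27 * d).valuation := by
    rw [Padic.valuation_mul (pow_ne_zero _ hd0) hD0, Padic.valuation_pow] at hΔ
    push_cast at hΔ; linarith
  have he_def : a ^ 3 - 24 * d = a ^ 3 + -(24 * d) := by ring
  have hD_def : a ^ 3 - 27 * d = a ^ 3 + -(27 * d) := by ring
  -- Step 1: `v(a) = 1`
  have hva : a.valuation = 1 := by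
    rcases lt_trichotomy a.valuation 1 with hlt | heq | hgt
    · -- `v(a) ≤ 0`: `v(e) = 2 − v(a) ≥ 2 > 3v(a) = v(a³)`, so cancellation: `v(24d) = v(a³)`
      exfalso
      have hvd : 1 + d.valuation = 3 * a.valuation := by
        by_contra hne
        rcases lt_or_gt_of_ne hne with h1 | h1
        · -- `v(24d) < v(a³)`: `v(e) = v(24d) = 1 + v(d)`
          have := (valuation_add_eq_left_of_lt 3 h24dne ha3 (by rw [h24d, hva3]; exact h1)).2
          rw [add_comm, ← he_def, h24d] at this
          omega
        · -- `v(a³) < v(24d)`: `v(e) = 3 v(a)`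
          have := (valuation_add_eq_left_of_lt 3 ha3 h24dne (by rw [h24d, hva3]; exact h1)).2
          rw [← he_def, hva3] at this
          omega
      -- then `v(27 d) = 3v(a) + 2 > v(a³)`, so `v(a³ − 27d) = 3 v(a)` and `v(Δ) = 12 v(a) − 3`
      have hvD : (a ^ 3 - 27 * d).valuation = 3 * a.valuation := by
        have := (valuation_add_eq_left_of_lt 3 ha3 h27dne (by rw [h27d, hva3]; omega)).2
        rw [← hD_def, hva3] at this; exact this
      omega
    · exact heq
    · -- `v(a) ≥ 2`: `v(e) = 2 − v(a) ≤ 0 < v(a³)`, so `v(e) = v(24 d)`: `v(d) = 1 − v(a)`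
      exfalso
      have hvd : 1 + d.valuation = 2 - a.valuation := by
        by_contra hne
        rcases lt_or_gt_of_ne hne with h1 | h1
        · -- `v(24d) < 2 − v(a)`: then also `v(24d) < v(a³)` and `v(e) = v(24 d)`
          have := (valuation_add_eq_left_of_lt 3 h24dne ha3 (by rw [h24d, hva3]; omega)).2
          rw [add_comm, ← he_def, h24d] at this
          omega
        · -- `v(24d) > 2 − v(a)`: `v(e) = min` is either `3v(a)` or `v(24 d)`, both `> 2 − v(a)`
          rcases lt_trichotomy (3 * a.valuation) (1 + d.valuation) with h2 | h2 | h2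
          · have := (valuation_add_eq_left_of_lt 3 ha3 h24dne (by rw [h24d, hva3]; exact h2)).2
            rw [← he_def, hva3] at this; omega
          · have hmin := Padic.le_valuation_add (he_def ▸ he0 : a ^ 3 + -(24 * d) ≠ 0)
            rw [← he_def, hva3, h24d, ← h2, min_self] at hmin
            omega
          · have := (valuation_add_eq_left_of_lt 3 h24dne ha3 (by rw [h24d, hva3]; exact h2)).2
            rw [add_comm, ← he_def, h24d] at this; omega
      have hvD : (a ^ 3 - 27 * d).valuation = 3 + d.valuation := by
        have := (valuation_add_eq_left_of_lt 3 h27dne ha3 (by rw [h27d, hva3]; omega)).2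
        rw [add_comm, ← hD_def, h27d] at this; exact this
      omega
  -- Step 2: `v(d) = 0`
  have hvd : d.valuation = 0 := by
    by_contra hne
    rcases lt_or_gt_of_ne hne with h1 | h1
    · -- `v(d) < 0`: `v(e) = v(24d) = 1 + v(d) < 1`, contradiction with `v(e) = 1`
      have := (valuation_add_eq_left_of_lt 3 h24dne ha3 (by rw [h24d, hva3]; omega)).2
      rw [add_comm, ← he_def, h24d] at this
      omega
    · -- `v(d) > 0`: `v(24 d) ≥ 2`; `v(e) = min (3, 1 + v d) ≥ 2`, contradiction with `v(e) = 1`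
      rcases lt_trichotomy (3 * a.valuation) (1 + d.valuation) with h2 | h2 | h2
      · have := (valuation_add_eq_left_of_lt 3 ha3 h24dne (by rw [h24d, hva3]; exact h2)).2
        rw [← he_def, hva3] at this; omega
      · have hmin := Padic.le_valuation_add (he_def ▸ he0 : a ^ 3 + -(24 * d) ≠ 0)
        rw [← he_def, hva3, h24d, ← h2, min_self] at hmin
        omega
      · have := (valuation_add_eq_left_of_lt 3 h24dne ha3 (by rw [h24d, hva3]; exact h2)).2
        rw [add_comm, ← he_def, h24d] at this; omega
  -- conclusions
  have h3inv : ‖(3 : ℚ_[3])‖ = (3 : ℝ)⁻¹ := by exact_mod_cast Padic.norm_p (p := 3)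
  refine ⟨ThreeTorsionNormalForm.norm_eq_one_iff.mpr ⟨hd0, hvd⟩, ?_, ?_⟩
  · rw [Padic.norm_eq_zpow_neg_valuation ha0, hva]; norm_num
  · -- `(a/3)³ − d = (a³ − 27 d)/27`, valuation `v(Δ) − 3 ≥ 3`
    have h27ne : (27 : ℚ_[3]) ≠ 0 := by norm_num
    have hq : (a / 3) ^ 3 - d = (a ^ 3 - 27 * d) / 27 := by field_simp; ring
    have hq0 : (a / 3) ^ 3 - d ≠ 0 := by rw [hq]; exact div_ne_zero hD0 h27ne
    have hvq : ((a / 3) ^ 3 - d).valuation = (a ^ 3 - 27 * d).valuation - 3 := by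
      rw [hq, div_eq_mul_inv, Padic.valuation_mul hD0 (inv_ne_zero h27ne), Padic.valuation_inv, hv27]
      ring
    rw [Padic.norm_eq_zpow_neg_valuation hq0, hvq]
    have e : ((3 : ℝ)⁻¹) ^ 3 = ((3 : ℕ) : ℝ) ^ (-3 : ℤ) := by norm_num
    rw [e]
    exact zpow_le_zpow_right₀ (by norm_num) (by omega)

end Shape

/-! ## §4 The local theorem: every `y` is a cube -/

/-- Integrality of `y`: on `y² + a₁xy + a₃y = x³` over `ℚ₃` with `‖a₁‖, ‖a₃‖ ≤ 1`, `‖x‖ ≤ 1` forces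
`‖y‖ ≤ 1` (else `‖y²‖` strictly dominates). [folklore] -/
private theorem norm_y_le_one {a₁ a₃ x y : ℚ_[3]} (ha₁ : ‖a₁‖ ≤ 1) (ha₃ : ‖a₃‖ ≤ 1)
    (h : y ^ 2 + a₁ * x * y + a₃ * y = x ^ 3) (hx : ‖x‖ ≤ 1) : ‖y‖ ≤ 1 := by
  by_contra hy
  rw [not_le] at hy
  have hy0 : 0 < ‖y‖ := zero_lt_one.trans hy
  have hT : ‖a₁ * x + a₃‖ ≤ 1 := by
    refine (Padic.nonarchimedean _ _).trans (max_le ?_ ha₃)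
    rw [norm_mul]
    calc ‖a₁‖ * ‖x‖ ≤ 1 * 1 := by gcongr
      _ = 1 := one_mul _
  have hlt : ‖(a₁ * x + a₃) * y‖ < ‖y ^ 2‖ := by
    rw [norm_mul, norm_pow, sq]
    calc ‖a₁ * x + a₃‖ * ‖y‖ ≤ 1 * ‖y‖ := by gcongr
      _ < ‖y‖ * ‖y‖ := by rw [one_mul]; exact lt_mul_of_one_lt_left hy0 hy
  have hsum : ‖y ^ 2 + (a₁ * x + a₃) * y‖ = ‖y‖ ^ 2 := by
    rw [Padic.add_eq_max_of_ne (ne_of_gt hlt), max_eq_left hlt.le, norm_pow]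
  have hx3 : ‖x ^ 3‖ ≤ 1 := by rw [norm_pow]; exact pow_le_one₀ (norm_nonneg _) hx
  have he : y ^ 2 + (a₁ * x + a₃) * y = x ^ 3 := by linear_combination h
  rw [he] at hsum
  nlinarith


/-- **T29.4 (b2)/(b3) in coordinates.** For `a, d ∈ ℚ₃` with `v₃(a(a³ − 24d)) = 2` and
`v₃(d³(a³ − 27d)) ≥ 6` (the `c₄` and `Δ` of the flex form), EVERY affine solution `(x, y)` over `ℚ₃` of
`y² + a·xy + d·y = x³` has `y ∈ ℚ₃³`.  By `norm_eq_of_valuation_c₄_Δ` the form is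
`y² + 3b·xy + d·y = x³` with units `b, d`, `b³ ≡ d (mod 27)`; a point with `‖x‖ > 1` has `y` a cube by
`ThreeTorsionNormalForm.exists_pow_three_eq_of_one_lt_norm` (x11b3-p7, p309913); an integral point by
`exists_pow_three_eq_of_integral`.  In the O5 lane's reading: the `φ̂`-Kummer map of the flex form is
trivial, `k = 0` — the Case-N cells `(1,1)`, `w ≥ 3` of o5-r1's T30 (`I₀*` pot-ordinary and `Iₙ*`).
[cite: DokchitserDokchitser2015LocalInvariantsIsogenous, Prop. 16–18 (arXiv:1208.5519 p. 8)] -/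
theorem exists_pow_three_eq_of_valuation_c₄_Δ {a d x y : ℚ_[3]} (hc₄0 : a * (a ^ 3 - 24 * d) ≠ 0)
    (hc₄ : (a * (a ^ 3 - 24 * d)).valuation = 2) (hΔ0 : d ^ 3 * (a ^ 3 - 27 * d) ≠ 0)
    (hΔ : 6 ≤ (d ^ 3 * (a ^ 3 - 27 * d)).valuation)
    (h : y ^ 2 + a * x * y + d * y = x ^ 3) : ∃ w : ℚ_[3], y = w ^ 3 := by
  obtain ⟨hd1, ha1, hbd⟩ := norm_eq_of_valuation_c₄_Δ hc₄0 hc₄ hΔ0 hΔ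
  have ha_lt : ‖a‖ < 1 := by rw [ha1]; norm_num
  by_cases hx : 1 < ‖x‖
  · exact ThreeTorsionNormalForm.exists_pow_three_eq_of_one_lt_norm ha_lt hd1.le h hx
  rw [not_lt] at hx
  have hy : ‖y‖ ≤ 1 := norm_y_le_one ha_lt.le hd1.le h hx
  have hb1 : ‖a / 3‖ ≤ 1 := by
    rw [norm_div, ha1]
    have : ‖(3 : ℚ_[3])‖ = (3 : ℝ)⁻¹ := by exact_mod_cast Padic.norm_p (p := 3)
    rw [this, div_self (by norm_num)]
  -- lift to `ℤ₃`
  obtain ⟨X, hXc⟩ : ∃ X : ℤ_[3], (X : ℚ_[3]) = x := ⟨⟨x, hx⟩, rfl⟩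
  obtain ⟨Y, hYc⟩ : ∃ Y : ℤ_[3], (Y : ℚ_[3]) = y := ⟨⟨y, hy⟩, rfl⟩
  obtain ⟨D, hDc⟩ : ∃ D : ℤ_[3], (D : ℚ_[3]) = d := ⟨⟨d, hd1.le⟩, rfl⟩
  obtain ⟨B, hBc⟩ : ∃ B : ℤ_[3], (B : ℚ_[3]) = a / 3 := ⟨⟨a / 3, hb1⟩, rfl⟩
  have hDu : IsUnit D := PadicInt.isUnit_iff.mpr (by rw [PadicInt.norm_def, hDc]; exact hd1)
  have h27 : (27 : ℤ_[3]) ∣ B ^ 3 - D := by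
    have hn : ‖B ^ 3 - D‖ ≤ ((3 : ℕ) : ℝ) ^ (-(3 : ℕ) : ℤ) := by
      rw [PadicInt.norm_def, PadicInt.coe_sub, PadicInt.coe_pow, hBc, hDc]
      convert hbd using 1
      norm_num
    have hmem := (PadicInt.norm_le_pow_iff_mem_span_pow (B ^ 3 - D) 3).1 hn
    rw [Ideal.mem_span_singleton] at hmem
    have e : ((3 : ℕ) : ℤ_[3]) ^ 3 = 27 := by norm_num
    rw [← e]; exact hmem
  have h3 : ((3 : ℤ_[3]) : ℚ_[3]) = 3 := by exact_mod_cast PadicInt.coe_natCast (p := 3) 3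
  have hE : Y ^ 2 + 3 * B * X * Y + D * Y = X ^ 3 := by
    apply Subtype.ext
    show ((Y ^ 2 + 3 * B * X * Y + D * Y : ℤ_[3]) : ℚ_[3]) = ((X ^ 3 : ℤ_[3]) : ℚ_[3])
    rw [PadicInt.coe_add, PadicInt.coe_add, PadicInt.coe_pow, PadicInt.coe_mul, PadicInt.coe_mul,
      PadicInt.coe_mul, PadicInt.coe_mul, PadicInt.coe_pow, h3, hXc, hYc, hBc, hDc]
    linear_combination h
  obtain ⟨w, hw⟩ := exists_pow_three_eq_of_integral hDu h27 hE
  exact ⟨w, hYc ▸ hw⟩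

end Summit.BirchSwinnertonDyer.Rank1Residual.O5.FlexTangent

end
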